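import Summits.CriticalPhenomena.PercolationContinuityZ3.Theorems.PercNearOneGluingNoHeavyLowerTailKnQuestion8CoefficientwiseCoreClassKernelMixPrefixHarris
import HarnessLib

/-!
# The prefix-frozen Harris inequality, II: counting form

Support file (`--supports stmt-CriticalPhenomena-4575`, closed), prover `prim-cplus-coupling` (gen 61).  No definitions, no notations, no named facts,
no sorries; standard axioms.  Memo `prim-cplus-coupling/A5-COUPLING-gen61.md` §1.  Companion of `…KernelMixPrefixHarris` (functional form).
* `Coefficientwise.prefix_frozen_count` — for an increasing predicate `Up` and a decreasing predicate `Dn` on the colourings of a ground set `E`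
  with a thread `e 1, …, e ℓ`:  `#(dark sources) + Σ_{a=1}^{ℓ} #(class-a prefix-frozen landings) ≤ #(global complement landings)`, i.e.
  `#(U ∩ W ∩ K_0) + Σ_{a ≥ 1} #(U ∩ τ_a(W ∩ K_a)) ≤ #(U ∩ c(W))` in the notation of the memo.  On a bundle with `U = 𝒲 ∩ {X ∈ 𝐀, Y ∉ 𝐁}`,
  `W = {b ∈ Y ∖ X, Y ∈ 𝐃, X ∉ 𝐂}` and the thread `z` read from the hub this is the linear one-type inequality `(***)` of memo gen 60 §3.8
  (dark type-1 sources + non-honest `z`-frozen type-1 landings ≤ `#L₁(𝒲)`), for every bundle and every thread; iterating it inside prefix classes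
  gives the same statement for any set of frozen threads.
[cite: KozmaNitzan2024, Questions 8–9 (§5.5 p. 36) (context); Harris 1960]
-/

namespace Summit.CriticalPhenomena.PercolationContinuityZ3.Theorems

open Finset

namespace Coefficientwise

variable {ι : Type*}

open Classical in
/-- **THE CUBE LEMMA, counting form.**  `E` a finite ground set, `e 1, …, e ℓ ∈ E` distinct, `Up` an increasing and `Dn` a decreasing predicate
on colourings (red sets).  DARK SOURCES: `ω ⊆ E` with `e 1 ∉ ω` (vacuous if `ℓ = 0`), `Up ω`, `Dn ω`.  CLASS-`a` LANDINGS (`1 ≤ a ≤ ℓ`): `ω ⊆ E` of red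
prefix length exactly `a` (`e 1..e a ∈ ω`, `e (a+1) ∉ ω` if `a < ℓ`) with `Up ω` and `Dn` of the PARTNER `E ∖ (ω ∆ {e 1..e (min (a+1) ℓ)})`
(= keep the frozen prefix, complement every other coordinate of `E`).  GLOBAL LANDINGS: `Up ω ∧ Dn (E ∖ ω)`.  Then
`#dark sources + Σ_{a=1}^{ℓ} #class-a landings ≤ #global landings`.  (Harris per class gives `#class-a sources ≤ #class-a landings`, so this
refines the one-type Kleitman bound: the dark sources fit into the global landings NOT claimed by the prefix-frozen schemes of the red-starting
classes.)  From `prefix_frozen_harris` with `F = 1_{Up}`, `G(ω) = 1_{Dn}(E ∖ ω)`.  Memo gen 61 §1.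
[cite: KozmaNitzan2024, Questions 8–9 (§5.5 p. 36) (context); Harris 1960] -/
theorem prefix_frozen_count [DecidableEq ι] (E : Finset ι) (ℓ : ℕ) (e : ℕ → ι)
    (heE : ∀ j, 1 ≤ j → j ≤ ℓ → e j ∈ E)
    (heinj : ∀ i j, 1 ≤ i → i ≤ ℓ → 1 ≤ j → j ≤ ℓ → e i = e j → i = j)
    (Up Dn : Finset ι → Prop)
    (Up_mono : ∀ s t : Finset ι, s ⊆ t → Up s → Up t) (Dn_anti : ∀ s t : Finset ι, s ⊆ t → Dn t → Dn s) :
    (E.powerset.filter (fun ω => (1 ≤ ℓ → e 1 ∉ ω) ∧ Up ω ∧ Dn ω)).card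
      + ∑ a ∈ Finset.Icc 1 ℓ, (E.powerset.filter (fun ω =>
          ((∀ j, 1 ≤ j → j ≤ a → e j ∈ ω) ∧ (a < ℓ → e (a + 1) ∉ ω))
            ∧ Up ω ∧ Dn (E \ symmDiff ω ((Finset.Icc 1 (min (a + 1) ℓ)).image e)))).card
    ≤ (E.powerset.filter (fun ω => Up ω ∧ Dn (E \ ω))).card := by
  -- pass to real sums
  set F : Finset ι → ℝ := fun ω => if Up ω then 1 else 0 with hF_def
  set G : Finset ι → ℝ := fun ω => if Dn (E \ ω) then 1 else 0 with hG_def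
  have hF : Monotone F := by
    intro s t hst
    simp only [hF_def]
    by_cases h : Up s
    · rw [if_pos h, if_pos (Up_mono s t hst h)]
    · rw [if_neg h]; split_ifs <;> norm_num
  have hG : Monotone G := by
    intro s t hst
    simp only [hG_def]
    by_cases h : Dn (E \ s)
    · rw [if_pos h, if_pos (Dn_anti _ _ (Finset.sdiff_subset_sdiff (le_refl E) hst) h)]
    · rw [if_neg h]; split_ifs <;> norm_num
  have main := prefix_frozen_harris ℓ E e heE heinj F G hF hG
  -- identify the three terms
  have hFG : ∀ (P Q : Prop) [Decidable P] [Decidable Q],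
      ((if P then (1:ℝ) else 0) * (if Q then 1 else 0)) = (if (P ∧ Q) then 1 else 0) := by
    intro P Q _ _
    by_cases hp : P <;> by_cases hq : Q <;> simp [hp, hq]
  have t_dark : (((E.powerset.filter (fun ω => (1 ≤ ℓ → e 1 ∉ ω) ∧ Up ω ∧ Dn ω)).card : ℕ) : ℝ)
      = ∑ ω ∈ E.powerset with (1 ≤ ℓ → e 1 ∉ ω), F ω * G (E \ ω) := by
    rw [Finset.natCast_card_filter, Finset.sum_filter]
    refine Finset.sum_congr rfl fun ω hω => ?_
    have hωE : ω ⊆ E := Finset.mem_powerset.mp hω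
    simp only [hF_def, hG_def]
    rw [Finset.sdiff_sdiff_eq_self hωE, hFG]
    by_cases h1 : (1 ≤ ℓ → e 1 ∉ ω)
    · rw [if_pos h1]
      by_cases h2 : Up ω ∧ Dn ω
      · rw [if_pos ⟨h1, h2⟩, if_pos h2]
      · rw [if_neg (fun h => h2 h.2), if_neg h2]
    · rw [if_neg (fun h => h1 h.1), if_neg h1]
  have t_cls : ∀ a ∈ Finset.Icc 1 ℓ,
      (((E.powerset.filter (fun ω => ((∀ j, 1 ≤ j → j ≤ a → e j ∈ ω) ∧ (a < ℓ → e (a + 1) ∉ ω))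
          ∧ Up ω ∧ Dn (E \ symmDiff ω ((Finset.Icc 1 (min (a + 1) ℓ)).image e)))).card : ℕ) : ℝ)
        = ∑ ω ∈ E.powerset with ((∀ j, 1 ≤ j → j ≤ a → e j ∈ ω) ∧ (a < ℓ → e (a + 1) ∉ ω)),
            F ω * G (symmDiff ω ((Finset.Icc 1 (min (a + 1) ℓ)).image e)) := by
    intro a _
    rw [Finset.natCast_card_filter, Finset.sum_filter]
    refine Finset.sum_congr rfl fun ω _ => ?_
    simp only [hF_def, hG_def]
    rw [hFG]
    by_cases h1 : ((∀ j, 1 ≤ j → j ≤ a → e j ∈ ω) ∧ (a < ℓ → e (a + 1) ∉ ω))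
    · rw [if_pos h1]
      by_cases h2 : Up ω ∧ Dn (E \ symmDiff ω ((Finset.Icc 1 (min (a + 1) ℓ)).image e))
      · rw [if_pos ⟨h1, h2⟩, if_pos h2]
      · rw [if_neg (fun h => h2 h.2), if_neg h2]
    · rw [if_neg (fun h => h1 h.1), if_neg h1]
  have t_glob : (((E.powerset.filter (fun ω => Up ω ∧ Dn (E \ ω))).card : ℕ) : ℝ) = ∑ ω ∈ E.powerset, F ω * G ω := by
    rw [Finset.natCast_card_filter]
    refine Finset.sum_congr rfl fun ω _ => ?_
    simp only [hF_def, hG_def]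
    rw [hFG]
  have key : (((E.powerset.filter (fun ω => (1 ≤ ℓ → e 1 ∉ ω) ∧ Up ω ∧ Dn ω)).card : ℕ) : ℝ)
      + ∑ a ∈ Finset.Icc 1 ℓ, (((E.powerset.filter (fun ω =>
          ((∀ j, 1 ≤ j → j ≤ a → e j ∈ ω) ∧ (a < ℓ → e (a + 1) ∉ ω))
            ∧ Up ω ∧ Dn (E \ symmDiff ω ((Finset.Icc 1 (min (a + 1) ℓ)).image e)))).card : ℕ) : ℝ)
      ≤ (((E.powerset.filter (fun ω => Up ω ∧ Dn (E \ ω))).card : ℕ) : ℝ) := by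
    rw [t_dark, t_glob, Finset.sum_congr rfl t_cls]
    exact main
  exact_mod_cast key

end Coefficientwise

end Summit.CriticalPhenomena.PercolationContinuityZ3.Theorems
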